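import Summits.PneNP.PneNP.Theorems.ConvexRankGatesLinAlgGateBlindDefs

/-!
# Route ConvexRankGates, crux `LinAlgGateBlind` (stmt-PneNP-10681): rigidity for BUNDLED span-program term gates

Support lemmas for the research stub `stub_sgPerm`, vocabulary of `Theorems/ConvexRankGatesLinAlgGateBlindDefs.lean`.
The files `Theorems/ConvexRankGatesLinAlgGateBlind{RigidSpanProgram,VisibleRigidity}.lean` treat span programs with
ONE row per clique atom. A PERM gate fed with atoms may own SEVERAL inputs per atom (`IsTermGate`: the atom map
`X : Fin g.1 → Finset (Fin m)` need not be injective), and the span programs inside abelian PERM gates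
(`Cruxes/LinAlgGateBlind/Disproof.lean`, `spanProgram_isPermGate`) are accordingly BUNDLED: rows `r a` indexed by
inputs `a : A` with an atom map `atom : A → 𝒱(l)`, `O(x) = [t ∈ span {r a : ⌈atom a⌉(x)}]`. This file restates the
two main criteria in that generality (the proofs are verbatim; the approximating family becomes
`𝒜 = atom '' {a : r a ∉ H}`):

* `sg_of_avoiding_subspace_bundled` — one `t`-avoiding subspace containing the present rows of every rejected
  `P`-graph gives `lostPos = ∅`, `gainedNeg ≤ Pr[¬P]`;
* `sg_of_rigidSpanProgram_bundled` — coordinate-free pairwise rigidity (every row generated modulo `t` by the rows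
  present in both of two `P`-graphs), any division ring;
* `sg_of_visiblyRigidSpanProgram_bundled` — equation form over a field with coordinates `ι`, a visibility predicate
  and locality per input, pairwise visible rigidity of the unit vectors.

No new definitions. [folklore]
-/

-- `Summit.PneNP.PneNP.…` duplicates `PneNP` BY DESIGN (single-problem summit).
set_option linter.dupNamespace false

namespace Summit.PneNP.PneNP.Theorems

open Finset Literature.Computability.Complexity Razborov
open Summit.PneNP.PneNP.Cruxes.LinAlgGateBlind.DnfInvariantWideGatesSeeSmallCliques

/-- **Main lemma, bundled form.** A subspace `H ∌ t` containing `r a` for every input `a` whose atom is present in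
some rejected `P`-graph yields `𝒜 = atom '' {a : r a ∉ H}` with `lostPos = ∅` and `gainedNeg ≤ Pr[¬P]`.
[folklore] -/
theorem sg_of_avoiding_subspace_bundled {m l k : ℕ} {q : ℝ} (hq0 : 0 ≤ q) (hq1 : q ≤ 1) {F V A : Type}
    [DivisionRing F] [AddCommGroup V] [Module F V] [Fintype A] (r : A → V) (atom : A → Finset (Fin m))
    (hatom : ∀ a, atom a ∈ smallSets (Fin m) l) (t : V) (O : (KEdge m → Bool) → Bool)
    (hO : ∀ x, O x = true ↔ t ∈ Submodule.span F (r '' {a | CliquePresent (atom a) x}))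
    (P : (KEdge m → Bool) → Prop) (H : Submodule F V) (htH : t ∉ H)
    (hH : ∀ G, P G → O G = false → ∀ a, CliquePresent (atom a) G → r a ∈ H) :
    ∃ 𝒜 ⊆ smallSets (Fin m) l, lostPos m k O 𝒜 = ∅ ∧ gainedNeg m q O 𝒜 ≤ prob q (fun G => ¬ P G) := by
  classical
  refine ⟨(univ.filter fun a => r a ∉ H).image atom, ?_, ?_, ?_⟩
  · intro Y hY
    obtain ⟨a, -, rfl⟩ := mem_image.1 hY
    exact hatom a
  · refine filter_eq_empty_iff.2 fun S _ h => ?_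
    obtain ⟨hS, hacc⟩ := h
    have htS := (hO _).1 hS
    have hle : Submodule.span F (r '' {a | CliquePresent (atom a) (cliqueVec S)}) ≤ H := by
      refine Submodule.span_le.2 ?_
      rintro _ ⟨a, ha, rfl⟩
      by_contra haH
      exact hacc ⟨atom a, mem_image.2 ⟨a, mem_filter.2 ⟨mem_univ _, haH⟩, rfl⟩, ha⟩
    exact htH (hle htS)
  · refine prob_mono hq0 hq1 fun G hG hPG => ?_
    obtain ⟨hOG, Y, hY, hYG⟩ := hG
    obtain ⟨a, ha, rfl⟩ := mem_image.1 hY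
    exact (mem_filter.1 ha).2 (hH G hPG hOG a hYG)

/-- **Pairwise rigidity ⇒ SG, bundled form** (cf. `sg_of_rigidSpanProgram`). [folklore] -/
theorem sg_of_rigidSpanProgram_bundled :
    ∀ (m l k : ℕ) (q : ℝ), 0 ≤ q → q ≤ 1 →
    ∀ {F V A : Type} [DivisionRing F] [AddCommGroup V] [Module F V] [Fintype A]
      (r : A → V) (atom : A → Finset (Fin m)), (∀ a, atom a ∈ smallSets (Fin m) l) →
    ∀ (t : V) (O : (KEdge m → Bool) → Bool),
      (∀ x, O x = true ↔ t ∈ Submodule.span F (r '' {a | CliquePresent (atom a) x})) →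
    ∀ (P : (KEdge m → Bool) → Prop),
      (∀ G G', P G → P G' → ∀ a,
        r a ∈ Submodule.span F (r '' {a' | CliquePresent (atom a') G ∧ CliquePresent (atom a') G'})
          ⊔ Submodule.span F {t}) →
      ∃ 𝒜 ⊆ smallSets (Fin m) l,
        lostPos m k O 𝒜 = ∅ ∧ gainedNeg m q O 𝒜 ≤ prob q (fun G => ¬ P G) := by
  intro m l k q hq0 hq1 F V A _ _ _ _ r atom hatom t O hO P hrigid
  classical
  set W : (KEdge m → Bool) → Submodule F V := fun x =>
    Submodule.span F (r '' {a | CliquePresent (atom a) x}) with hW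
  have hOW : ∀ x, O x = false → t ∉ W x := fun x hx htx => by
    have := (hO x).2 htx
    rw [hx] at this
    exact Bool.false_ne_true this
  by_cases hwit : ∃ G₁, P G₁ ∧ O G₁ = false
  · obtain ⟨G₁, hP₁, hO₁⟩ := hwit
    refine sg_of_avoiding_subspace_bundled hq0 hq1 r atom hatom t O hO P (W G₁) (hOW G₁ hO₁) ?_
    intro G hPG hOG a haG
    have htG : t ∉ W G := hOW G hOG
    have hra := hrigid G₁ G hP₁ hPG a
    rw [Submodule.mem_sup] at hra
    obtain ⟨u, hu, z, hz, huz⟩ := hra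
    obtain ⟨c, rfl⟩ := Submodule.mem_span_singleton.1 hz
    have hboth : Submodule.span F (r '' {a' | CliquePresent (atom a') G₁ ∧ CliquePresent (atom a') G}) ≤
        W G₁ ⊓ W G := by
      refine Submodule.span_le.2 ?_
      rintro _ ⟨a', ⟨h1, h2⟩, rfl⟩
      exact ⟨Submodule.subset_span ⟨a', h1, rfl⟩, Submodule.subset_span ⟨a', h2, rfl⟩⟩
    have hu₁ : u ∈ W G₁ := (hboth hu).1
    have huG : u ∈ W G := (hboth hu).2
    have hraG : r a ∈ W G := Submodule.subset_span ⟨a, haG, rfl⟩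
    have hct : c • t ∈ W G := by
      have : c • t = r a - u := by rw [← huz]; abel
      rw [this]
      exact (W G).sub_mem hraG huG
    have hc : c = 0 := by
      by_contra hc
      exact htG (((W G).smul_mem_iff hc).1 hct)
    subst hc
    rw [zero_smul, add_zero] at huz
    rw [← huz]
    exact hu₁
  · push Not at hwit
    refine ⟨{∅}, by simp, ?_, ?_⟩
    · exact filter_eq_empty_iff.2 fun S _ h => h.2 (accepts_of_empty_mem (mem_singleton_self _) _)
    · exact prob_mono hq0 hq1 fun G hG hPG => absurd hG.1 (hwit G hPG)

/-- **Visible rigidity ⇒ SG, bundled form** (cf. `sg_of_visiblyRigidSpanProgram`): equation form over a field,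
rows `(c a, b a)` per input `a`, locality of the visibility predicate per input, pairwise visible rigidity of the
unit vectors. [folklore] -/
theorem sg_of_visiblyRigidSpanProgram_bundled :
    ∀ (m l k : ℕ) (q : ℝ), 0 ≤ q → q ≤ 1 →
    ∀ {F ι A : Type} [Field F] [Fintype ι] [DecidableEq ι] [Fintype A]
      (c : A → ι → F) (b : A → F) (atom : A → Finset (Fin m)), (∀ a, atom a ∈ smallSets (Fin m) l) →
    ∀ (O : (KEdge m → Bool) → Bool),
      (∀ x, O x = true ↔ ((0 : ι → F), (1 : F)) ∈ Submodule.span F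
        ((fun a : A => (c a, b a)) '' {a | CliquePresent (atom a) x})) →
    ∀ (Vis : (KEdge m → Bool) → ι → Prop),
      (∀ (x : KEdge m → Bool) (a : A) (i : ι), CliquePresent (atom a) x → c a i ≠ 0 → Vis x i) →
    ∀ (P : (KEdge m → Bool) → Prop),
      (∀ G G', P G → P G' → ∀ i, Vis G i → Vis G' i →
        ((Pi.single i (1 : F) : ι → F), (0 : F)) ∈ Submodule.span F
            ((fun a : A => (c a, b a)) '' {a | CliquePresent (atom a) G ∧ CliquePresent (atom a) G'})
          ⊔ Submodule.span F {((0 : ι → F), (1 : F))}) →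
      ∃ 𝒜 ⊆ smallSets (Fin m) l,
        lostPos m k O 𝒜 = ∅ ∧ gainedNeg m q O 𝒜 ≤ prob q (fun G => ¬ P G) := by
  intro m l k q hq0 hq1 F ι A _ _ _ _ c b atom hatom O hO Vis hVis P hrigid
  classical
  set r : A → (ι → F) × F := fun a => (c a, b a) with hr
  set t : (ι → F) × F := ((0 : ι → F), (1 : F)) with ht
  set W : (KEdge m → Bool) → Submodule F ((ι → F) × F) := fun x =>
    Submodule.span F (r '' {a | CliquePresent (atom a) x}) with hW
  have hOW : ∀ x, O x = false → t ∉ W x := fun x hx htx => by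
    have := (hO x).2 htx
    rw [hx] at this
    exact Bool.false_ne_true this
  -- Step 1: a normalised functional per rejected graph
  have hex : ∀ G, ∃ φ : Module.Dual F ((ι → F) × F),
      O G = false → (φ t = 1 ∧ ∀ w ∈ W G, φ w = 0) := by
    intro G
    by_cases hG : O G = false
    · obtain ⟨f, hft, hfW⟩ := (W G).exists_dual_map_eq_bot_of_notMem (hOW G hG) inferInstance
      refine ⟨(f t)⁻¹ • f, fun _ => ⟨?_, fun w hw => ?_⟩⟩
      · rw [LinearMap.smul_apply, smul_eq_mul, inv_mul_cancel₀ hft]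
      · have : f w ∈ (W G).map f := Submodule.mem_map_of_mem hw
        rw [hfW, Submodule.mem_bot] at this
        rw [LinearMap.smul_apply, this, smul_zero]
    · exact ⟨0, fun h => absurd h hG⟩
  choose Φ hΦ using hex
  -- Step 2: agreement on commonly visible coordinates
  have hagree : ∀ G₁ G₂, P G₁ → P G₂ → O G₁ = false → O G₂ = false → ∀ i, Vis G₁ i → Vis G₂ i →
      Φ G₁ (Pi.single i 1, 0) = Φ G₂ (Pi.single i 1, 0) := by
    intro G₁ G₂ hP₁ hP₂ hO₁ hO₂ i hi₁ hi₂
    have hmem := hrigid G₁ G₂ hP₁ hP₂ i hi₁ hi₂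
    rw [Submodule.mem_sup] at hmem
    obtain ⟨u, hu, z, hz, huz⟩ := hmem
    obtain ⟨a, rfl⟩ := Submodule.mem_span_singleton.1 hz
    have hboth : Submodule.span F (r '' {a' | CliquePresent (atom a') G₁ ∧ CliquePresent (atom a') G₂}) ≤
        W G₁ ⊓ W G₂ := by
      refine Submodule.span_le.2 ?_
      rintro _ ⟨a', ⟨h1, h2⟩, rfl⟩
      exact ⟨Submodule.subset_span ⟨a', h1, rfl⟩, Submodule.subset_span ⟨a', h2, rfl⟩⟩
    have h1 : Φ G₁ (Pi.single i 1, 0) = a := by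
      rw [← huz, map_add, (hΦ G₁ hO₁).2 u (hboth hu).1, map_smul, (hΦ G₁ hO₁).1, smul_eq_mul, mul_one,
        zero_add]
    have h2 : Φ G₂ (Pi.single i 1, 0) = a := by
      rw [← huz, map_add, (hΦ G₂ hO₂).2 u (hboth hu).2, map_smul, (hΦ G₂ hO₂).1, smul_eq_mul, mul_one,
        zero_add]
    rw [h1, h2]
  -- Step 3: one global vector of coordinate values
  have hθ : ∀ i, ∃ θi : F, ∀ G, P G → O G = false → Vis G i → θi = Φ G (Pi.single i 1, 0) := by
    intro i
    by_cases h : ∃ G₀, P G₀ ∧ O G₀ = false ∧ Vis G₀ i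
    · obtain ⟨G₀, hP₀, hO₀, hi₀⟩ := h
      exact ⟨Φ G₀ (Pi.single i 1, 0), fun G hP hOG hi => hagree G₀ G hP₀ hP hO₀ hOG i hi₀ hi⟩
    · push Not at h
      exact ⟨0, fun G hP hOG hi => absurd hi (h G hP hOG)⟩
  choose θ hθ using hθ
  -- Step 4: the global functional `ψ (v, β) = β + Σ_i v i * θ i`
  let ψ : ((ι → F) × F) →ₗ[F] F :=
    { toFun := fun v => v.2 + ∑ i, v.1 i * θ i
      map_add' := fun v w => by
        simp only [Prod.snd_add, Prod.fst_add, Pi.add_apply, add_mul, sum_add_distrib]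
        abel
      map_smul' := fun a v => by
        simp only [Prod.smul_snd, Prod.smul_fst, Pi.smul_apply, smul_eq_mul, RingHom.id_apply, mul_add,
          mul_sum, mul_assoc] }
  have hψ_apply : ∀ v : (ι → F) × F, ψ v = v.2 + ∑ i, v.1 i * θ i := fun v => rfl
  have hψt : ψ t = 1 := by
    rw [hψ_apply, ht]
    simp
  have hkill : ∀ G, P G → O G = false → ∀ a, CliquePresent (atom a) G → ψ (r a) = 0 := by
    intro G hPG hOG a haG
    have hrW : r a ∈ W G := Submodule.subset_span ⟨a, haG, rfl⟩
    have hφr : Φ G (r a) = 0 := (hΦ G hOG).2 _ hrW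
    have hdec : r a = (∑ i, c a i • ((Pi.single i (1 : F) : ι → F), (0 : F))) + b a • t := by
      refine Prod.ext ?_ ?_
      · funext j
        simp only [hr, ht, Prod.fst_add, Prod.fst_sum, Prod.smul_fst, Pi.add_apply, Finset.sum_apply,
          Pi.smul_apply, Pi.single_apply, smul_eq_mul, mul_ite, mul_one, mul_zero, Pi.zero_apply,
          add_zero]
        rw [Finset.sum_ite_eq]
        simp
      · simp [hr, ht, Prod.snd_sum]
    have hφexp : Φ G (r a) = (∑ i, c a i * Φ G (Pi.single i 1, 0)) + b a := by
      rw [hdec, map_add, map_sum, map_smul, (hΦ G hOG).1, smul_eq_mul, mul_one]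
      congr 1
      exact sum_congr rfl fun i _ => by rw [map_smul, smul_eq_mul]
    have hsum : ∑ i, c a i * θ i = ∑ i, c a i * Φ G (Pi.single i 1, 0) := by
      refine sum_congr rfl fun i _ => ?_
      by_cases hci : c a i = 0
      · rw [hci, zero_mul, zero_mul]
      · rw [hθ i G hPG hOG (hVis G a i haG hci)]
    rw [hψ_apply]
    change b a + ∑ i, c a i * θ i = 0
    rw [hsum, add_comm, ← hφexp, hφr]
  refine sg_of_avoiding_subspace_bundled hq0 hq1 r atom hatom t O hO P (LinearMap.ker ψ) ?_ ?_
  · rw [LinearMap.mem_ker, hψt]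
    exact one_ne_zero
  · intro G hPG hOG a haG
    exact (LinearMap.mem_ker).2 (hkill G hPG hOG a haG)

end Summit.PneNP.PneNP.Theorems
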